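import Summits.QuantumFields.BalabanUV.T4Continuum.Support.ShellMeasureRootCompositionSeam
import Summits.QuantumFields.BalabanUV.T4Continuum.Support.ShellMeasureRootCompositionLevelZero

/-!
# `T4Continuum.ShellMeasureRootCompositionSeamCube` — row S13 file 2: the per-slot supplier of the SEAM END-I ∘ END-II
# on the CUBE form of END-II (dictionary asked on `[-S,S]ⁿ` only)
# (cell `pub-balaban`, sub-cell `t4`, spine estimate NE7c (node U5b); NE7c ROUND-2 crew seat leaf-08, row S13 of
# `t4/b2b-balaban-t4-ne7c-p1/LEAVES-NE7c-P1.md`; the owner's ruling l.6163 (1) «ALL CONSUMERS wire to the `_cube` form»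
# after finding F-ne7cleaf09-1; ADDITIVE — imports `ShellMeasureRootCompositionSeam` (S13 file 1, p208381) and
# `ShellMeasureRootCompositionLevelZero` (S11 file 2, p208890) only; 0 `def`, 0 sorry, 0 citations)

HONEST FRAMING.  Finite four-torus programme, rung (B)+1 only — NOT infinite volume, NOT a mass gap, NOT the Clay
problem, NOT summit progress.  NE7c = `T4IndicatorShell.ShellWeightBound` is NOT PRINTED in [Balaban 1983–89] and NOT
PROVED; (M1) for Bałaban's inductively defined effective measures is NOT PRINTED (GAPS G-ne7cp1-1), asserted by nobody
and NOT moved here.  BOOKKEEPING (trigger c3 «NE7c ⇐ the named binders»): file 1's §3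
`ShellMeasureRootCompositionSeam.slotAC_realized_su2_of_levelData_le` composes END-II v1
(`ShellMeasureRootCompositionSU2.slotAC_realized_su2_of_levelData`, p207698), whose DICTIONARY binders `hRdict`/`hudict`
are quantified over ALL chart points `x ∈ ℝⁿ` — jointly inhabitable by the cell's objects only vacuously at level 0
(finding F-ne7cleaf09-1, accepted by the row owner l.6163: the exponential chart is `2π`-periodic per bond).  The CUBE
form `ShellMeasureRootCompositionLevelZero.slotAC_realized_su2_of_levelData_cube` (p208890) asks them for
`x ∈ cube n S` only, everything else byte-identical.  This file is the twin of file 1's §3 on the cube form: END-II-cube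
+ ONE displayed level majorant `2(n + β Σ_p L̄_p(d̄_p + 4s̄_p) + B_𝓔)/(1−δ) ≤ D_j` + the (SM) binder in the clean form
`36H/(Rad−1)² ≤ δθ` ⟹ (M1) for the realized slot measure with the LEVEL constant `D_j` — the per-slot input `hacX` of
file 1's `shellWeightBound_of_levelDataSU2` (via `hac_of_levelData` with `Dslot := D ∘ lvl`, `hDslot := le_rfl`, or
directly).  File 1's §1/§2/§4 are at END-II's OUTPUT level and need no change.  0 sorry, 0 citations.  HONEST DEPENDENCY
(cell): continuum YM on T⁴ ⇐ BetaPertH ∧ nine spine estimates (0/9 proved); BetaPertH ⇐ (D1) ∧ (D4) ∧ CAP+tail; G-an2-4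
gates asym, D1 and NE2/3/4.

## What is proved ([folklore] bookkeeping)
* `slotAC_realized_su2_of_levelData_cube_le`: END-II (cube form) + level majorant + clean (SM) ⟹
  `SlotAntiConcentration ((fieldMeasure P j SU2).withDensity F) u θ ρ D_j`.
* `slotAC_realized_su2_of_levelData_cube_clean`: the cube form with the clean (SM) binder and END-II's own slot
  constant (no majorant) — the `DslotX`-supplier shape of file 1's §4.
WHAT THIS DOES NOT DO.  No estimate binder discharged (SM-L1…L8 displayed); (M1), NE7c NOT proved; 0/9 spine.
-/

noncomputable section

open NormedSpace Set Function MeasureTheory Metric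
open scoped ENNReal

namespace Summit.QuantumFields.BalabanUV.T4Continuum.ShellMeasureRootCompositionSeam

open Literature.MathematicalPhysics.QuantumFieldTheory.Balaban1983to89
open GaugeField (GaugeInvariant)
open T4ShellMeasure (SlotAntiConcentration)
open T4ShellMeasureFibre (slotAntiConcentration_mono)
open T4CubePoincare (cube)
open T4CubeChartGnomonic (SU2)
open T4CubeChartExp (expWindowDensity expFibreChart)
open T4ShellMeasureDet (blockLaw)
open T4TreeGaugeFixing (NoClosedLoop fixTo)
open ShellMeasureWilsonTrace (TraceData)
open ShellMeasureWilsonMoving (MLetter mwordEval mdFro sSum lSum)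
open ShellMeasureLevelAssembly (classifier weight)
open ShellMeasureRootCompositionLevelZero (slotAC_realized_su2_of_levelData_cube)

variable {P : Params} {j : ℕ} [DecidableEq (PBond P j)]
variable {A : Type*} [NormedRing A] [NormedAlgebra ℂ A] [CompleteSpace A] [NormOneClass A]

/-- **END-II (CUBE FORM), (SM) IN CLEAN FORM.**  The binders of
`ShellMeasureRootCompositionLevelZero.slotAC_realized_su2_of_levelData_cube` verbatim — dictionary `hRdict`/`hudict` on
`cube n S` only — except the smallness binder written `36H/(Rad − 1)² ≤ δθ` (instead of the `x₀ = 1` artefact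
`36·H·1²/(Rad − 1)²`) ⟹ (M1) for the realized slot measure with END-II's SLOT constant
`2(n + β Σ_p L̄_p(d̄_p + 4s̄_p) + B_𝓔)/(1−δ)` — the shape of file 1's `hacX` with `DslotX`.  CONDITIONAL on every binder;
nothing PRINTED is asserted. [folklore] -/
theorem slotAC_realized_su2_of_levelData_cube_clean {T : Finset (PBond P j)} (hT : NoClosedLoop T)
    (U₀ : GaugeField P j SU2) (Λ : Finset (PBond P j)) {n : ℕ} (e : ↥Λ × Fin 3 ≃ Fin n)
    {S : ℝ} (hS : 0 < S) (hSπ : 3 * S ^ 2 < Real.pi ^ 2) (c : GaugeField P j SU2 → GaugeField P j SU2)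
    {R : GaugeField P j SU2 → (↥Λ → SU2) → ℝ≥0∞} (hR : ∀ V, Measurable (R V))
    {F : GaugeField P j SU2 → ℝ≥0∞} (hF : Measurable F) (hFi : GaugeInvariant F)
    (hFw : ∀ V y, F (fixTo T U₀ (updateFinset V Λ y)) =
      ENNReal.ofReal (expWindowDensity Λ (c V) S (updateFinset (c V) Λ y)) * R V y)
    (hfin : ∀ V, ((blockLaw Λ).withDensity fun y => F (fixTo T U₀ (updateFinset V Λ y))) univ ≠ ∞)
    {u : GaugeField P j SU2 → ℝ} (hu : Measurable u) (hui : GaugeInvariant u)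
    (Ttr : TraceData A) (hN : 0 < Ttr.N) {ι κ : Type*} {Pu : Finset ι} (hPu : Pu.Nonempty)
    (hol : GaugeField P j SU2 → ι → (Fin n → ℝ) → A) (hcont : ∀ V, ∀ p ∈ Pu, Continuous (hol V p))
    (Pw : Finset κ) (G : GaugeField P j SU2 → κ → (Fin n → ℝ) → A) (𝓔 : GaugeField P j SU2 → (Fin n → ℝ) → ℝ)
    (W : GaugeField P j SU2 → Set (Fin n → ℝ)) (Jco : GaugeField P j SU2 → (Fin n → ℝ) → ℝ≥0∞)
    {θ δ ρ β Rad H B𝓔 : ℝ} {sw lw dw : κ → ℝ}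
    -- DICTIONARY on the chart cube only
    (hRdict : ∀ V, ∀ x ∈ cube n S, R V (expFibreChart Λ (c V) e x) = Jco V x * weight Ttr β Pw (G V) (𝓔 V) x)
    (hudict : ∀ V, ∀ x ∈ cube n S,
      u (fixTo T U₀ (updateFinset V Λ (expFibreChart Λ (c V) e x))) = classifier hPu (hol V) x)
    -- SM-L5/L6
    (hJW : ∀ V x, Jco V x ≠ 0 → x ∈ W V)
    (hJ : ∀ V x, ∀ a : ℝ, 0 ≤ a → Jco V x ≤ Jco V (Real.exp (-a) • x))
    -- SM-L1 (AN-bound)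
    (hRad : 1 < Rad)
    (hAN : ∀ V, ∀ x ∈ W V, ∀ p ∈ Pu, ∃ f : ℂ → A, DifferentiableOn ℂ f (ball 0 Rad) ∧
      (∀ w ∈ ball (0 : ℂ) Rad, ‖f w‖ ≤ H) ∧ f 0 = 0 ∧ ∀ c' : ℝ, 0 ≤ c' → c' ≤ 1 → f (c' : ℂ) = hol V p (c' • x) - 1)
    -- SM-L3 graded sectioned words
    (hGW : ∀ V, ∀ x ∈ W V, ∀ p ∈ Pw, ∃ gw : List (MLetter A × ℝ × ℝ), (∀ y ∈ gw, y.1.Good Ttr.τ y.2.1 y.2.2) ∧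
      sSum gw ≤ sw p ∧ lSum gw ≤ lw p ∧ mdFro (gw.map Prod.fst) ≤ dw p ∧
      ∀ c' : ℝ, 0 ≤ c' → c' ≤ 1 → mwordEval c' (gw.map Prod.fst) = G V p (c' • x))
    (hsw1 : ∀ p ∈ Pw, sw p ≤ 1) (hsw0 : ∀ p ∈ Pw, 0 ≤ sw p) (hlw0 : ∀ p ∈ Pw, 0 ≤ lw p)
    (hdw0 : ∀ p ∈ Pw, 0 ≤ dw p)
    -- SM-L4 non-Wilson ray bound
    (hE : ∀ V, ∀ x ∈ W V, ∀ c' : ℝ, 1 / 2 ≤ c' → c' ≤ 1 → 𝓔 V (c' • x) ≤ 𝓔 V x + (1 - c') * B𝓔) (hB𝓔 : 0 ≤ B𝓔)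
    -- numbers + SM-L2 (SM) clean
    (hθ : 0 < θ) (hδ0 : 0 ≤ δ) (hδ1 : δ < 1) (hρ0 : 0 ≤ ρ) (hρ : ρ ≤ (1 - δ) / 2) (hβ : 0 ≤ β)
    (hSM : 36 * H / (Rad - 1) ^ 2 ≤ δ * θ) :
    SlotAntiConcentration ((fieldMeasure P j SU2).withDensity F) u θ ρ
      (2 * ((n : ℝ) + (β * ∑ p ∈ Pw, lw p * (dw p + 4 * sw p) + B𝓔)) / (1 - δ)) :=
  slotAC_realized_su2_of_levelData_cube hT U₀ Λ e hS hSπ c hR hF hFi hFw hfin hu hui Ttr hN hPu hol hcont Pw G 𝓔 W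
    Jco hRdict hudict hJW hJ hRad hAN hGW hsw1 hsw0 hlw0 hdw0 hE hB𝓔 hθ hδ0 hδ1 hρ0 hρ hβ
    (by simpa only [one_pow, mul_one] using hSM)

/-- **END-II (CUBE FORM) WITH A LEVEL MAJORANT, ONE SLOT** — the twin of file 1's `slotAC_realized_su2_of_levelData_le`
on the cube form: the binders of `slotAC_realized_su2_of_levelData_cube_clean` plus ONE displayed majorant
`2(n + β Σ_p L̄_p(d̄_p + 4s̄_p) + B_𝓔)/(1−δ) ≤ D_j` ⟹ (M1) for the realized slot measure with the LEVEL constant `D_j`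
(`T4ShellMeasureFibre.slotAntiConcentration_mono`) — the per-slot input `hacX` of file 1's
`shellWeightBound_of_levelDataSU2` with `DslotX := DX ∘ lvlX`.  CONDITIONAL on every binder; nothing PRINTED is
asserted. [folklore] -/
theorem slotAC_realized_su2_of_levelData_cube_le {T : Finset (PBond P j)} (hT : NoClosedLoop T)
    (U₀ : GaugeField P j SU2) (Λ : Finset (PBond P j)) {n : ℕ} (e : ↥Λ × Fin 3 ≃ Fin n)
    {S : ℝ} (hS : 0 < S) (hSπ : 3 * S ^ 2 < Real.pi ^ 2) (c : GaugeField P j SU2 → GaugeField P j SU2)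
    {R : GaugeField P j SU2 → (↥Λ → SU2) → ℝ≥0∞} (hR : ∀ V, Measurable (R V))
    {F : GaugeField P j SU2 → ℝ≥0∞} (hF : Measurable F) (hFi : GaugeInvariant F)
    (hFw : ∀ V y, F (fixTo T U₀ (updateFinset V Λ y)) =
      ENNReal.ofReal (expWindowDensity Λ (c V) S (updateFinset (c V) Λ y)) * R V y)
    (hfin : ∀ V, ((blockLaw Λ).withDensity fun y => F (fixTo T U₀ (updateFinset V Λ y))) univ ≠ ∞)
    {u : GaugeField P j SU2 → ℝ} (hu : Measurable u) (hui : GaugeInvariant u)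
    (Ttr : TraceData A) (hN : 0 < Ttr.N) {ι κ : Type*} {Pu : Finset ι} (hPu : Pu.Nonempty)
    (hol : GaugeField P j SU2 → ι → (Fin n → ℝ) → A) (hcont : ∀ V, ∀ p ∈ Pu, Continuous (hol V p))
    (Pw : Finset κ) (G : GaugeField P j SU2 → κ → (Fin n → ℝ) → A) (𝓔 : GaugeField P j SU2 → (Fin n → ℝ) → ℝ)
    (W : GaugeField P j SU2 → Set (Fin n → ℝ)) (Jco : GaugeField P j SU2 → (Fin n → ℝ) → ℝ≥0∞)
    {θ δ ρ β Rad H B𝓔 Dj : ℝ} {sw lw dw : κ → ℝ}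
    (hRdict : ∀ V, ∀ x ∈ cube n S, R V (expFibreChart Λ (c V) e x) = Jco V x * weight Ttr β Pw (G V) (𝓔 V) x)
    (hudict : ∀ V, ∀ x ∈ cube n S,
      u (fixTo T U₀ (updateFinset V Λ (expFibreChart Λ (c V) e x))) = classifier hPu (hol V) x)
    (hJW : ∀ V x, Jco V x ≠ 0 → x ∈ W V)
    (hJ : ∀ V x, ∀ a : ℝ, 0 ≤ a → Jco V x ≤ Jco V (Real.exp (-a) • x))
    (hRad : 1 < Rad)
    (hAN : ∀ V, ∀ x ∈ W V, ∀ p ∈ Pu, ∃ f : ℂ → A, DifferentiableOn ℂ f (ball 0 Rad) ∧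
      (∀ w ∈ ball (0 : ℂ) Rad, ‖f w‖ ≤ H) ∧ f 0 = 0 ∧ ∀ c' : ℝ, 0 ≤ c' → c' ≤ 1 → f (c' : ℂ) = hol V p (c' • x) - 1)
    (hGW : ∀ V, ∀ x ∈ W V, ∀ p ∈ Pw, ∃ gw : List (MLetter A × ℝ × ℝ), (∀ y ∈ gw, y.1.Good Ttr.τ y.2.1 y.2.2) ∧
      sSum gw ≤ sw p ∧ lSum gw ≤ lw p ∧ mdFro (gw.map Prod.fst) ≤ dw p ∧
      ∀ c' : ℝ, 0 ≤ c' → c' ≤ 1 → mwordEval c' (gw.map Prod.fst) = G V p (c' • x))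
    (hsw1 : ∀ p ∈ Pw, sw p ≤ 1) (hsw0 : ∀ p ∈ Pw, 0 ≤ sw p) (hlw0 : ∀ p ∈ Pw, 0 ≤ lw p)
    (hdw0 : ∀ p ∈ Pw, 0 ≤ dw p)
    (hE : ∀ V, ∀ x ∈ W V, ∀ c' : ℝ, 1 / 2 ≤ c' → c' ≤ 1 → 𝓔 V (c' • x) ≤ 𝓔 V x + (1 - c') * B𝓔) (hB𝓔 : 0 ≤ B𝓔)
    (hθ : 0 < θ) (hδ0 : 0 ≤ δ) (hδ1 : δ < 1) (hρ0 : 0 ≤ ρ) (hρ : ρ ≤ (1 - δ) / 2) (hβ : 0 ≤ β)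
    (hSM : 36 * H / (Rad - 1) ^ 2 ≤ δ * θ)
    -- the displayed level majorant of the slot constant
    (hDj : 2 * ((n : ℝ) + (β * ∑ p ∈ Pw, lw p * (dw p + 4 * sw p) + B𝓔)) / (1 - δ) ≤ Dj) :
    SlotAntiConcentration ((fieldMeasure P j SU2).withDensity F) u θ ρ Dj :=
  slotAntiConcentration_mono hρ0 hDj
    (slotAC_realized_su2_of_levelData_cube_clean hT U₀ Λ e hS hSπ c hR hF hFi hFw hfin hu hui Ttr hN hPu hol hcont Pw
      G 𝓔 W Jco hRdict hudict hJW hJ hRad hAN hGW hsw1 hsw0 hlw0 hdw0 hE hB𝓔 hθ hδ0 hδ1 hρ0 hρ hβ hSM)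

end Summit.QuantumFields.BalabanUV.T4Continuum.ShellMeasureRootCompositionSeam
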